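import Mathlib.Analysis.Complex.RemovableSingularity
import Mathlib.Analysis.Complex.Exponential
import Mathlib.Analysis.SpecialFunctions.ImproperIntegrals
import Mathlib.MeasureTheory.Integral.IntegralEqImproper
import Literature.Analysis.Complex.ZeroSumVariation
import HarnessLib

/-!
# Perron's formula with a pole of higher order: poles `x^s s^{-(m+1)}`, `m ≥ 1`

Trunk: Analysis / Complex (contour integration on rectangles), serving Goldston–Pintz–Yıldırım,
*Primes in tuples I* (Ann. of Math. 170 (2009) = arXiv:math/0508185), §6, formula (6.6), p. 12 —
the Mellin inversion behind `T_R(N; H) = (1/2πi)∫_(1) F(s) R^s s^{-k-1} ds` ((6.7), (7.7)). Mathlib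
and the tree have Perron's kernel of order one (`LFunctions/PerronKernel.lean`, the conditionally
convergent `∫ y^s ds/s`) and Cauchy's formula for simple poles on rectangles
(`Literature.Analysis.Complex.integral_boundary_rect_div_sub_eq`); this file adds the poles of order `m + 1 ≥ 2`,
where everything converges absolutely. Everything here is PROVED.

* `Literature.Analysis.Complex.rectBoundaryIntegral_exp_mul_div_pow` — for `L : ℂ` and a rectangle with `0` inside,
  `∮_{∂R} e^{sL} s^{−(m+1)} ds = 2πi L^m/m!` (any `m : ℕ`); `rectBoundaryIntegral_cpow_div_pow` —
  the case `L = log x`, `x > 0`: `∮_{∂R} x^s s^{−(m+1)} ds = 2πi (log x)^m/m!`;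
* `Literature.Analysis.Complex.integral_perronPow_vertical` — **GPY (6.6)** for `m ≥ 1`, `c > 0`, `x > 0`:
  `∫_{−∞}^{∞} x^{c+it} (c+it)^{−(m+1)} dt = 2π · [x ≥ 1] · (log x)^m/m!`
  (`integrable_perronPow_vertical`: the integral converges absolutely).

## Proof

The residue at the pole of order `m + 1` is computed without Cauchy's formula for derivatives: with
`L = log x`, `x^s = e^{sL} = T_m(s) + s^m h_m(s)` where `T_m` is the Taylor polynomial of degree
`< m` and `h_m(s) = (e^{sL} − T_m(s))/s^m`, `h_m(0) = L^m/m!`, is ENTIRE (`differentiable_expRem`: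
Riemann's removable singularity criterion, the bound coming from Mathlib's `Complex.exp_bound` and
the recursion `h_m = L^m/m! + s h_{m+1}`). Hence `x^s/s^{m+1} = h_m(s)/s + T_m(s)/s^{m+1}`;
the first term integrates to `2πi h_m(0)` by the tree's rectangle Cauchy formula, the second to
`0` since
`∮ s^k ds = 0` for `k ≤ −2` (the tree's `rectBoundaryIntegral_deriv_eq_zero`,
`ZeroSumVariation.lean`). The line integral is then the limit
of rectangles `[−T, c] × [−T, T]` (`x ≥ 1`) or `[c, T] × [−T, T]` (`x < 1`, no pole,
Cauchy–Goursat),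
whose three other sides are `≪ x^c (c + T) T^{−m−1} + T^{−m} → 0`, using absolute convergence on
`Re s = c` (`‖x^s s^{−m−1}‖ ≪ (1 + t²)^{−1}`).

## References

* D. A. Goldston, J. Pintz, C. Y. Yıldırım, *Primes in tuples. I*, Ann. of Math. (2) 170 (2009),
  819–862 = arXiv:math/0508185, §6, (6.6), p. 12. [cite: GoldstonPintzYildirim2009]
-/

noncomputable section

open Complex Set Filter Topology MeasureTheory intervalIntegral
open scoped Interval

namespace Literature.Analysis.Complex



/-- `T_m(s) = ∑_{i<m} (sL)^i/i!`, the Taylor polynomial of degree `< m` of `e^{sL}` at `0`.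
[folklore] -/
def taylorExp (L : ℂ) (m : ℕ) (s : ℂ) : ℂ := ∑ i ∈ Finset.range m, (s * L) ^ i / (i.factorial : ℂ)

/-- The normalised remainder `h_m(s) = (e^{sL} − T_m(s))/s^m` (`s ≠ 0`), `h_m(0) = L^m/m!`:
an entire function (`differentiable_expRem`), the device replacing the Cauchy formula for higher
derivatives
in the residue computation `Res_{s=0} x^s s^{−m−1} = (log x)^m/m!` behind GPY (6.6). (Equivalently
`h_m = (dslope · 0)^[m] (s ↦ e^{sL})`, and `differentiable_expRem` is Mathlib's
`Complex.differentiableOn_dslope` iterated; here it is obtained directly from the recursion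
`h_m = L^m/m! + s h_{m+1}` and `Complex.exp_bound`.) [folklore] -/
def expRem (L : ℂ) (m : ℕ) (s : ℂ) : ℂ :=
  if s = 0 then L ^ m / (m.factorial : ℂ) else (exp (s * L) - taylorExp L m s) / s ^ m

/-- `T_0 = 0`. [folklore] -/
theorem taylorExp_zero (L : ℂ) (s : ℂ) : taylorExp L 0 s = 0 := by simp [taylorExp]

/-- `T_{m+1}(s) = T_m(s) + (sL)^m/m!`. [folklore] -/
theorem taylorExp_succ (L : ℂ) (m : ℕ) (s : ℂ) :
    taylorExp L (m + 1) s = taylorExp L m s + (s * L) ^ m / (m.factorial : ℂ) := by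
  simp [taylorExp, Finset.sum_range_succ]

/-- `h_m(0) = L^m/m!`. [folklore] -/
theorem expRem_zero_apply (L : ℂ) (m : ℕ) : expRem L m 0 = L ^ m / (m.factorial : ℂ) := by
  simp [expRem]

/-- `h_m(s) = (e^{sL} − T_m(s))/s^m` for `s ≠ 0`. [folklore] -/
theorem expRem_of_ne_zero (L : ℂ) (m : ℕ) {s : ℂ} (hs : s ≠ 0) :
    expRem L m s = (exp (s * L) - taylorExp L m s) / s ^ m := by
  simp [expRem, hs]

/-- `e^{sL} − T_m(s) = s^m h_m(s)` for all `s`. [folklore] -/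
theorem exp_sub_taylorExp (L : ℂ) (m : ℕ) (s : ℂ) :
    exp (s * L) - taylorExp L m s = s ^ m * expRem L m s := by
  rcases eq_or_ne s 0 with rfl | hs
  · rw [expRem_zero_apply]
    cases m with
    | zero => simp [taylorExp]
    | succ m =>
      simp [taylorExp, Finset.sum_range_succ', zero_pow (Nat.succ_ne_zero _)]
  · rw [expRem_of_ne_zero L m hs, mul_div_cancel₀ _ (pow_ne_zero _ hs)]

/-- The recursion `h_m(s) = L^m/m! + s·h_{m+1}(s)`. [folklore] -/
theorem expRem_succ (L : ℂ) (m : ℕ) (s : ℂ) :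
    expRem L m s = L ^ m / (m.factorial : ℂ) + s * expRem L (m + 1) s := by
  rcases eq_or_ne s 0 with rfl | hs
  · simp [expRem_zero_apply]
  · rw [expRem_of_ne_zero L m hs, expRem_of_ne_zero L (m + 1) hs, taylorExp_succ]
    have hsm : s ^ m ≠ 0 := pow_ne_zero _ hs
    have hsm1 : s ^ (m + 1) ≠ 0 := pow_ne_zero _ hs
    field_simp
    ring

/-- Near `0`: `‖h_m(s)‖ ≤ 2‖L‖^m` for `‖sL‖ ≤ 1`, `m ≥ 1` (Mathlib's `Complex.exp_bound`).
[folklore] -/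
theorem norm_expRem_le {L : ℂ} {m : ℕ} (hm : 1 ≤ m) {s : ℂ} (hs : ‖s * L‖ ≤ 1) :
    ‖expRem L m s‖ ≤ 2 * ‖L‖ ^ m := by
  rcases eq_or_ne s 0 with rfl | hs0
  · rw [expRem_zero_apply, norm_div, norm_pow]
    have hf : (1 : ℝ) ≤ ‖(m.factorial : ℂ)‖ := by
      rw [Complex.norm_natCast]; exact_mod_cast Nat.one_le_iff_ne_zero.2 (Nat.factorial_ne_zero m)
    calc ‖L‖ ^ m / ‖(m.factorial : ℂ)‖ ≤ ‖L‖ ^ m / 1 :=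
          div_le_div_of_nonneg_left (by positivity) one_pos hf
      _ ≤ 2 * ‖L‖ ^ m := by rw [div_one]; linarith [pow_nonneg (norm_nonneg L) m]
  · rw [expRem_of_ne_zero L m hs0, norm_div, norm_pow]
    have hb := Complex.exp_bound hs (by omega : 0 < m)
    have hT : taylorExp L m s = ∑ i ∈ Finset.range m, (s * L) ^ i / (i.factorial : ℂ) := rfl
    rw [hT] at *
    have hcoef : ((m.succ : ℝ) * ((m.factorial : ℝ) * m)⁻¹) ≤ 2 := by
      rw [← div_eq_mul_inv, div_le_iff₀ (by positivity)]
      have h1 : (1 : ℝ) ≤ m.factorial := by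
        exact_mod_cast Nat.one_le_iff_ne_zero.2 (Nat.factorial_ne_zero m)
      have h2 : (1 : ℝ) ≤ m := by exact_mod_cast hm
      push_cast
      nlinarith
    have hsn : 0 < ‖s‖ ^ m := pow_pos (norm_pos_iff.2 hs0) m
    rw [div_le_iff₀ hsn]
    calc ‖exp (s * L) - ∑ i ∈ Finset.range m, (s * L) ^ i / (i.factorial : ℂ)‖
        ≤ ‖s * L‖ ^ m * ((m.succ : ℝ) * ((m.factorial : ℝ) * m)⁻¹) := hb
      _ ≤ ‖s * L‖ ^ m * 2 := mul_le_mul_of_nonneg_left hcoef (by positivity)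
      _ = 2 * ‖L‖ ^ m * ‖s‖ ^ m := by rw [norm_mul, mul_pow]; ring

/-- `h_m` is continuous at `0` (from the recursion and the bound for `h_{m+1}`). [folklore] -/
theorem continuousAt_expRem (L : ℂ) (m : ℕ) : ContinuousAt (expRem L m) 0 := by
  rw [ContinuousAt, expRem_zero_apply]
  -- `h_m(s) − L^m/m! = s h_{m+1}(s)` with `h_{m+1}` bounded near `0`
  have hev : ∀ᶠ s : ℂ in 𝓝 0,
      ‖expRem L m s - L ^ m / (m.factorial : ℂ)‖ ≤ ‖s‖ * (2 * ‖L‖ ^ (m + 1)) := by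
    have hball : ∀ᶠ s : ℂ in 𝓝 0, ‖s * L‖ ≤ 1 := by
      rcases eq_or_ne L 0 with rfl | hL
      · exact Filter.Eventually.of_forall fun s => by simp
      · have hr : 0 < ‖L‖⁻¹ := inv_pos.2 (norm_pos_iff.2 hL)
        filter_upwards [Metric.ball_mem_nhds (0 : ℂ) hr] with s hs
        rw [Metric.mem_ball, dist_zero_right] at hs
        rw [norm_mul]
        calc ‖s‖ * ‖L‖ ≤ ‖L‖⁻¹ * ‖L‖ := mul_le_mul_of_nonneg_right hs.le (norm_nonneg L)
          _ = 1 := inv_mul_cancel₀ (norm_ne_zero_iff.2 hL)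
    filter_upwards [hball] with s hs
    rw [expRem_succ L m s, add_sub_cancel_left, norm_mul]
    exact mul_le_mul_of_nonneg_left (norm_expRem_le (by omega) hs) (norm_nonneg s)
  rw [tendsto_iff_norm_sub_tendsto_zero]
  refine squeeze_zero_norm' (by simpa using hev) ?_
  have : Tendsto (fun s : ℂ => ‖s‖ * (2 * ‖L‖ ^ (m + 1))) (𝓝 0)
      (𝓝 (‖(0 : ℂ)‖ * (2 * ‖L‖ ^ (m + 1)))) :=
    (continuous_norm.tendsto 0).mul tendsto_const_nhds
  simpa using this

/-- `h_m` is entire: differentiable off `0` by the explicit formula, and at `0` by Riemann's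
removable singularity criterion
(`Complex.differentiableOn_compl_singleton_and_continuousAt_iff`). [folklore] -/
theorem differentiable_expRem (L : ℂ) (m : ℕ) : Differentiable ℂ (expRem L m) := by
  have hd : DifferentiableOn ℂ (expRem L m) (Set.univ \ {0}) := by
    have h1 : DifferentiableOn ℂ (fun s : ℂ => (exp (s * L) - taylorExp L m s) / s ^ m)
        (Set.univ \ {0}) := by
      refine DifferentiableOn.div ?_ ?_ fun s hs => pow_ne_zero _ (by simpa using hs)
      · unfold taylorExp; fun_prop
      · fun_prop
    exact h1.congr fun s hs => expRem_of_ne_zero L m (by simpa using hs)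
  have h := (Complex.differentiableOn_compl_singleton_and_continuousAt_iff
    (Filter.univ_mem : (Set.univ : Set ℂ) ∈ 𝓝 (0 : ℂ))).1 ⟨hd, continuousAt_expRem L m⟩
  exact differentiableOn_univ.1 h

/-! ### The rectangle identity -/

/-- A point with nonzero imaginary part is nonzero. [folklore] -/
theorem ne_zero_of_im_ne {z : ℂ} {y : ℝ} (hz : z.im = y) (hy : y ≠ 0) : z ≠ 0 := by
  rintro rfl; simp at hz; exact hy hz.symm

/-- A point with nonzero real part is nonzero. [folklore] -/
theorem ne_zero_of_re_ne {z : ℂ} {x : ℝ} (hz : z.re = x) (hx : x ≠ 0) : z ≠ 0 := by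
  rintro rfl; simp at hz; exact hx hz.symm

/-- Cauchy's formula (the tree's `Literature.Analysis.Complex.integral_boundary_rect_div_sub_eq`) for the
entire `h_m`: `∮_{∂R} h_m(s)/s ds = 2πi L^m/m!` for a rectangle with `0` inside. [folklore] -/
theorem rectBoundaryIntegral_expRem_div (L : ℂ) (m : ℕ) {a b c d : ℝ} (ha : a < 0) (hb : 0 < b)
    (hc : c < 0) (hd : 0 < d) :
    Literature.Analysis.Complex.rectBoundaryIntegral (fun s => expRem L m s / s) a b c d =
      2 * Real.pi * I * (L ^ m / (m.factorial : ℂ)) := by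
  have h := Literature.Analysis.Complex.integral_boundary_rect_div_sub_eq (f := expRem L m) 0
    (by simpa using ha) (by simpa using hb) (by simpa using hc) (by simpa using hd)
    (differentiable_expRem L m).differentiableOn
  simp only [sub_zero] at h
  rw [Literature.Analysis.Complex.rectBoundaryIntegral_def, h, expRem_zero_apply]

/-- `∮_{∂R} s^k ds = 0` for an integer `k ≠ −1` over a rectangle with `0` in its open interior:
`s^k` is the derivative of `s^{k+1}/(k+1)`, analytic at every boundary point, so the tree's
`rectBoundaryIntegral_deriv_eq_zero` (`ZeroSumVariation.lean`) applies. [folklore] -/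
theorem rectBoundaryIntegral_zpow_eq_zero {k : ℤ} (hk : k + 1 ≠ 0) {a b c d : ℝ} (ha : a < 0)
    (hb : 0 < b) (hc : c < 0) (hd : 0 < d) :
    rectBoundaryIntegral (fun s => s ^ k) a b c d = 0 := by
  have hab : a ≤ b := (ha.trans hb).le
  have hcd : c ≤ d := (hc.trans hd).le
  have hk' : ((k + 1 : ℤ) : ℂ) ≠ 0 := by exact_mod_cast hk
  set h : ℂ → ℂ := fun z => ((k + 1 : ℤ) : ℂ)⁻¹ * z ^ (k + 1) with hhdef
  have hderiv : ∀ z : ℂ, z ≠ 0 → deriv h z = z ^ k := by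
    intro z hz
    rw [hhdef, ((hasDerivAt_zpow (k + 1) z (Or.inl hz)).const_mul _).deriv]
    simp only [add_sub_cancel_right]
    field_simp
  have han : ∀ z : ℂ, z ≠ 0 → AnalyticAt ℂ h z := fun z hz =>
    analyticAt_const.mul (analyticAt_id.zpow (by simpa using hz))
  have hbot0 : ∀ x : ℝ, ((x : ℂ) + c * I) ≠ 0 := fun x => ne_zero_of_im_ne (by simp) hc.ne
  have htop0 : ∀ x : ℝ, ((x : ℂ) + d * I) ≠ 0 := fun x => ne_zero_of_im_ne (by simp) hd.ne'
  have hleft0 : ∀ y : ℝ, ((a : ℂ) + y * I) ≠ 0 := fun y => ne_zero_of_re_ne (by simp) ha.ne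
  have hright0 : ∀ y : ℝ, ((b : ℂ) + y * I) ≠ 0 := fun y => ne_zero_of_re_ne (by simp) hb.ne'
  rw [rectBoundaryIntegral_congr (G := deriv h) hab hcd (fun x _ => (hderiv _ (hbot0 x)).symm)
    (fun x _ => (hderiv _ (htop0 x)).symm) (fun y _ => (hderiv _ (hleft0 y)).symm)
    (fun y _ => (hderiv _ (hright0 y)).symm)]
  exact rectBoundaryIntegral_deriv_eq_zero hab hcd (fun x _ => han _ (hbot0 x))
    (fun x _ => han _ (htop0 x)) (fun y _ => han _ (hleft0 y)) (fun y _ => han _ (hright0 y))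

/-- `T_{m+1}(s)/s^n = T_m(s)/s^n + (L^m/m!) s^{m−n}` (`s ≠ 0`). [folklore] -/
theorem taylorExp_succ_div_pow (L : ℂ) (m n : ℕ) {s : ℂ} (hs : s ≠ 0) :
    taylorExp L (m + 1) s / s ^ n =
      taylorExp L m s / s ^ n + L ^ m / (m.factorial : ℂ) * s ^ ((m : ℤ) - n) := by
  rw [taylorExp_succ, add_div, mul_pow, zpow_sub₀ hs, zpow_natCast, zpow_natCast]
  ring

/-- `T_m` is continuous. [folklore] -/
theorem continuous_taylorExp (L : ℂ) (m : ℕ) : Continuous (taylorExp L m) := by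
  unfold taylorExp; fun_prop

/-- `∮_{∂R} T_m(s)/s^n ds = 0` for `n ≥ m + 1` (all exponents `≤ −2`; induction on `m`).
[folklore] -/
theorem rectBoundaryIntegral_taylorExp_div_pow (L : ℂ) {a b c d : ℝ} (ha : a < 0) (hb : 0 < b)
    (hc : c < 0) (hd : 0 < d) (m : ℕ) :
    ∀ n : ℕ, m + 1 ≤ n →
      Literature.Analysis.Complex.rectBoundaryIntegral (fun s => taylorExp L m s / s ^ n) a b c d = 0 := by
  have hab : a ≤ b := (ha.trans hb).le
  have hcd : c ≤ d := (hc.trans hd).le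
  -- boundary points are nonzero
  have hbot0 : ∀ x : ℝ, ((x : ℂ) + c * I) ≠ 0 := fun x => ne_zero_of_im_ne (by simp) hc.ne
  have htop0 : ∀ x : ℝ, ((x : ℂ) + d * I) ≠ 0 := fun x => ne_zero_of_im_ne (by simp) hd.ne'
  have hleft0 : ∀ y : ℝ, ((a : ℂ) + y * I) ≠ 0 := fun y => ne_zero_of_re_ne (by simp) ha.ne
  have hright0 : ∀ y : ℝ, ((b : ℂ) + y * I) ≠ 0 := fun y => ne_zero_of_re_ne (by simp) hb.ne'
  induction m with
  | zero =>
    intro n _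
    simp only [taylorExp_zero, zero_div]
    simp [Literature.Analysis.Complex.rectBoundaryIntegral]
  | succ m ih =>
    intro n hn
    have hT : ∀ z : ℂ, z ≠ 0 → ContinuousAt (fun s => taylorExp L m s / s ^ n) z := fun z hz =>
      ((continuous_taylorExp L m).continuousAt).div (by fun_prop) (pow_ne_zero _ hz)
    have hP : ∀ z : ℂ, z ≠ 0 →
        ContinuousAt (fun s : ℂ => L ^ m / (m.factorial : ℂ) * s ^ ((m : ℤ) - n)) z := fun z hz =>
      (continuousAt_const.mul (continuousAt_zpow₀ z _ (Or.inl hz)))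
    rw [Literature.Analysis.Complex.rectBoundaryIntegral_congr
      (G := fun s => taylorExp L m s / s ^ n + L ^ m / (m.factorial : ℂ) * s ^ ((m : ℤ) - n))
      hab hcd
      (fun x _ => taylorExp_succ_div_pow L m n (hbot0 x))
      (fun x _ => taylorExp_succ_div_pow L m n (htop0 x))
      (fun y _ => taylorExp_succ_div_pow L m n (hleft0 y))
      (fun y _ => taylorExp_succ_div_pow L m n (hright0 y))]
    rw [Literature.Analysis.Complex.rectBoundaryIntegral_add hab hcd (fun x _ => hT _ (hbot0 x))
      (fun x _ => hT _ (htop0 x)) (fun y _ => hT _ (hleft0 y)) (fun y _ => hT _ (hright0 y))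
      (fun x _ => hP _ (hbot0 x)) (fun x _ => hP _ (htop0 x)) (fun y _ => hP _ (hleft0 y))
      (fun y _ => hP _ (hright0 y)),
      ih n (by omega), Literature.Analysis.Complex.rectBoundaryIntegral_const_mul,
      rectBoundaryIntegral_zpow_eq_zero (by omega) ha hb hc hd]
    ring

/-- **The residue of `e^{sL} s^{−(m+1)}` at `0` on a rectangle**: for any `L : ℂ`, `m : ℕ` and
`[a,b] × [c,d]` with `0` in its open interior, `∮_{∂R} e^{sL} s^{−(m+1)} ds = 2πi L^m/m!`
(`e^{sL} = s^m h_m(s) + T_m(s)`; Cauchy for `h_m/s`, zero for `T_m/s^{m+1}`). [folklore] -/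
theorem rectBoundaryIntegral_exp_mul_div_pow (L : ℂ) (m : ℕ) {a b c d : ℝ} (ha : a < 0)
    (hb : 0 < b) (hc : c < 0) (hd : 0 < d) :
    rectBoundaryIntegral (fun s => exp (s * L) / s ^ (m + 1)) a b c d =
      2 * Real.pi * I * (L ^ m / (m.factorial : ℂ)) := by
  have hab : a ≤ b := (ha.trans hb).le
  have hcd : c ≤ d := (hc.trans hd).le
  have hsplit : ∀ s : ℂ, s ≠ 0 →
      exp (s * L) / s ^ (m + 1) = expRem L m s / s + taylorExp L m s / s ^ (m + 1) := by
    intro s hs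
    rw [show exp (s * L) = s ^ m * expRem L m s + taylorExp L m s by
      rw [← exp_sub_taylorExp]; ring]
    have hsm : s ^ (m + 1) ≠ 0 := pow_ne_zero _ hs
    field_simp
    ring
  have hbot0 : ∀ t : ℝ, ((t : ℂ) + c * I) ≠ 0 := fun t => ne_zero_of_im_ne (by simp) hc.ne
  have htop0 : ∀ t : ℝ, ((t : ℂ) + d * I) ≠ 0 := fun t => ne_zero_of_im_ne (by simp) hd.ne'
  have hleft0 : ∀ y : ℝ, ((a : ℂ) + y * I) ≠ 0 := fun y => ne_zero_of_re_ne (by simp) ha.ne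
  have hright0 : ∀ y : ℝ, ((b : ℂ) + y * I) ≠ 0 := fun y => ne_zero_of_re_ne (by simp) hb.ne'
  have hE : ∀ z : ℂ, z ≠ 0 → ContinuousAt (fun s => expRem L m s / s) z := fun z hz =>
    ((differentiable_expRem L m).continuous.continuousAt).div continuousAt_id hz
  have hT : ∀ z : ℂ, z ≠ 0 → ContinuousAt (fun s => taylorExp L m s / s ^ (m + 1)) z := fun z hz =>
    ((continuous_taylorExp L m).continuousAt).div (by fun_prop) (pow_ne_zero _ hz)
  rw [rectBoundaryIntegral_congr
    (G := fun s => expRem L m s / s + taylorExp L m s / s ^ (m + 1)) hab hcd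
    (fun t _ => hsplit _ (hbot0 t))
    (fun t _ => hsplit _ (htop0 t)) (fun y _ => hsplit _ (hleft0 y))
    (fun y _ => hsplit _ (hright0 y)),
    rectBoundaryIntegral_add hab hcd (fun t _ => hE _ (hbot0 t))
      (fun t _ => hE _ (htop0 t))
      (fun y _ => hE _ (hleft0 y)) (fun y _ => hE _ (hright0 y)) (fun t _ => hT _ (hbot0 t))
      (fun t _ => hT _ (htop0 t)) (fun y _ => hT _ (hleft0 y)) (fun y _ => hT _ (hright0 y)),
    rectBoundaryIntegral_expRem_div L m ha hb hc hd,
    rectBoundaryIntegral_taylorExp_div_pow L ha hb hc hd m (m + 1) le_rfl, add_zero]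

/-- **The residue of `x^s s^{−(m+1)}` at `0` on a rectangle** (the case `L = log x` of
`rectBoundaryIntegral_exp_mul_div_pow`): for `x > 0`, `m : ℕ` and `[a,b] × [c,d]` with `0` in its
open interior, `∮_{∂R} x^s s^{−(m+1)} ds = 2πi (log x)^m/m!`.
[cite: GoldstonPintzYildirim2009, Section 6 eq. 6.6] -/
theorem rectBoundaryIntegral_cpow_div_pow {x : ℝ} (hx : 0 < x) (m : ℕ) {a b c d : ℝ} (ha : a < 0)
    (hb : 0 < b) (hc : c < 0) (hd : 0 < d) :
    rectBoundaryIntegral (fun s => (x : ℂ) ^ s / s ^ (m + 1)) a b c d =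
      2 * Real.pi * I * (((Real.log x : ℝ) : ℂ) ^ m / (m.factorial : ℂ)) := by
  have hxs : (fun s : ℂ => (x : ℂ) ^ s / s ^ (m + 1)) =
      fun s => exp (s * ((Real.log x : ℝ) : ℂ)) / s ^ (m + 1) := by
    funext s
    rw [Complex.cpow_def_of_ne_zero (by exact_mod_cast hx.ne'), ← Complex.ofReal_log hx.le,
      mul_comm]
  rw [hxs]
  exact rectBoundaryIntegral_exp_mul_div_pow _ m ha hb hc hd

/-- The integrand `x^s / s^{m+1}` of GPY (6.6), for real `x > 0` (the only intended range) and
`m : ℕ`. Junk value: `perronPow x m 0 = 0` (Lean's `z / 0 = 0` at the pole); every lemma below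
assumes `s ≠ 0` or works on lines and edges avoiding `0`.
[cite: GoldstonPintzYildirim2009, Section 6 eq. 6.6] -/
def perronPow (x : ℝ) (m : ℕ) (s : ℂ) : ℂ := (x : ℂ) ^ s / s ^ (m + 1)

/-- `‖x^s/s^{m+1}‖ = x^{σ}/|s|^{m+1}` on `s = σ + it`. [folklore] -/
theorem norm_perronPow {x : ℝ} (hx : 0 < x) (m : ℕ) (σ t : ℝ) :
    ‖perronPow x m ((σ : ℂ) + t * I)‖ = x ^ σ / ‖(σ : ℂ) + t * I‖ ^ (m + 1) := by
  rw [perronPow, norm_div, norm_pow, norm_cpow_eq_rpow_re_of_pos hx]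
  simp

/-- `|t| ≤ |σ + it|`. [folklore] -/
theorem abs_im_le_norm_line (σ t : ℝ) : |t| ≤ ‖(σ : ℂ) + t * I‖ := by
  simpa using abs_im_le_norm ((σ : ℂ) + t * I)

/-- `|σ| ≤ |σ + it|`. [folklore] -/
theorem abs_re_le_norm_line (σ t : ℝ) : |σ| ≤ ‖(σ : ℂ) + t * I‖ := by
  simpa using abs_re_le_norm ((σ : ℂ) + t * I)

/-- On a horizontal segment at height `y ≠ 0`: `‖x^s/s^{m+1}‖ ≤ x^{Re s}/|y|^{m+1}`. [folklore] -/
theorem norm_perronPow_le_horizontal {x : ℝ} (hx : 0 < x) (m : ℕ) (t : ℝ) {y : ℝ} (hy : y ≠ 0) :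
    ‖perronPow x m ((t : ℂ) + y * I)‖ ≤ x ^ t / |y| ^ (m + 1) := by
  rw [norm_perronPow hx]
  exact div_le_div_of_nonneg_left (Real.rpow_nonneg hx.le _) (pow_pos (abs_pos.2 hy) _)
    (pow_le_pow_left₀ (abs_nonneg _) (abs_im_le_norm_line t y) _)

/-- On a vertical segment at abscissa `σ ≠ 0`: `‖x^s/s^{m+1}‖ ≤ x^σ/|σ|^{m+1}`. [folklore] -/
theorem norm_perronPow_le_vertical {x : ℝ} (hx : 0 < x) (m : ℕ) {σ : ℝ} (hσ : σ ≠ 0) (t : ℝ) :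
    ‖perronPow x m ((σ : ℂ) + t * I)‖ ≤ x ^ σ / |σ| ^ (m + 1) := by
  rw [norm_perronPow hx]
  exact div_le_div_of_nonneg_left (Real.rpow_nonneg hx.le _) (pow_pos (abs_pos.2 hσ) _)
    (pow_le_pow_left₀ (abs_nonneg _) (abs_re_le_norm_line σ t) _)

/-- `x^s/s^{m+1}` is complex differentiable away from `s = 0`. [folklore] -/
theorem differentiableAt_perronPow {x : ℝ} (hx : 0 < x) (m : ℕ) {s : ℂ} (hs : s ≠ 0) :
    DifferentiableAt ℂ (perronPow x m) s := by
  unfold perronPow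
  refine DifferentiableAt.div ?_ (by fun_prop) (pow_ne_zero _ hs)
  exact (differentiableAt_id.const_cpow (Or.inl (by exact_mod_cast hx.ne')))

/-- `x^s/s^{m+1}` is continuous away from `s = 0`. [folklore] -/
theorem continuousAt_perronPow {x : ℝ} (hx : 0 < x) (m : ℕ) {s : ℂ} (hs : s ≠ 0) :
    ContinuousAt (perronPow x m) s := (differentiableAt_perronPow hx m hs).continuousAt

/-- Continuity along a vertical line `Re s = σ ≠ 0`. [folklore] -/
theorem continuous_perronPow_vertical {x : ℝ} (hx : 0 < x) (m : ℕ) {σ : ℝ} (hσ : σ ≠ 0) :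
    Continuous fun t : ℝ => perronPow x m ((σ : ℂ) + t * I) := by
  have hne : ∀ t : ℝ, ((σ : ℂ) + t * I) ≠ 0 := fun t h => by
    have := congrArg Complex.re h; simp at this; exact hσ this
  exact continuous_iff_continuousAt.2 fun t =>
    (continuousAt_perronPow hx m (hne t)).comp (f := fun t : ℝ => (σ : ℂ) + t * I) (by fun_prop)

/-- Absolute convergence of `∫_(σ) x^s s^{−(m+1)} ds` for `m ≥ 1`, `σ ≠ 0`:
`‖x^{σ+it}/(σ+it)^{m+1}‖ ≤ C (1 + t²)⁻¹`. [folklore] -/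
theorem integrable_perronPow_vertical {x : ℝ} (hx : 0 < x) {m : ℕ} (hm : 1 ≤ m) {σ : ℝ}
    (hσ : σ ≠ 0) :
    Integrable fun t : ℝ => perronPow x m ((σ : ℂ) + t * I) := by
  set C : ℝ := x ^ σ * (2 / |σ| ^ (m + 1) + (1 + 1 / σ ^ 2)) with hCdef
  have hσ2 : 0 < σ ^ 2 := by positivity
  have hσa : 0 < |σ| := abs_pos.2 hσ
  refine Integrable.mono' ((integrable_inv_one_add_sq).const_mul C)
    (continuous_perronPow_vertical hx m hσ).aestronglyMeasurable
    (Filter.Eventually.of_forall fun t => ?_)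
  rw [norm_perronPow hx]
  set n : ℝ := ‖(σ : ℂ) + t * I‖ with hndef
  have hnσ : |σ| ≤ n := abs_re_le_norm_line σ t
  have hnt : |t| ≤ n := abs_im_le_norm_line σ t
  have hn0 : 0 < n := lt_of_lt_of_le hσa hnσ
  have hnsq : n ^ 2 = σ ^ 2 + t ^ 2 := by
    rw [hndef, Complex.sq_norm, Complex.normSq_apply]; simp; ring
  have hxσ : 0 ≤ x ^ σ := Real.rpow_nonneg hx.le _
  -- `1/n^{m+1} ≤ 2/|σ|^{m+1} · (1+t²)⁻¹ + (1 + 1/σ²) (1+t²)⁻¹`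
  have key : 1 / n ^ (m + 1) ≤ (2 / |σ| ^ (m + 1) + (1 + 1 / σ ^ 2)) * (1 + t ^ 2)⁻¹ := by
    have h1t : 0 < 1 + t ^ 2 := by positivity
    rw [le_mul_inv_iff₀ h1t]
    rcases le_or_gt 1 n with hn1 | hn1
    · -- `n ≥ 1`: `1/n^{m+1} ≤ 1/n² = 1/(σ²+t²) ≤ (1 + 1/σ²)/(1+t²)`
      have hpow : n ^ 2 ≤ n ^ (m + 1) := pow_le_pow_right₀ hn1 (by omega)
      have h2 : 1 / n ^ (m + 1) ≤ 1 / n ^ 2 := one_div_le_one_div_of_le (by positivity) hpow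
      have h3 : 1 / n ^ 2 * (1 + t ^ 2) ≤ 1 + 1 / σ ^ 2 := by
        rw [hnsq, div_mul_eq_mul_div, one_mul, div_le_iff₀ (by positivity)]
        have : t ^ 2 ≤ (σ ^ 2 + t ^ 2) := by linarith
        have h4 : 1 ≤ (1 / σ ^ 2) * (σ ^ 2 + t ^ 2) := by
          rw [one_div, inv_mul_eq_div, le_div_iff₀ hσ2]; linarith [sq_nonneg t]
        nlinarith
      calc 1 / n ^ (m + 1) * (1 + t ^ 2) ≤ 1 / n ^ 2 * (1 + t ^ 2) :=
            mul_le_mul_of_nonneg_right h2 h1t.le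
        _ ≤ 1 + 1 / σ ^ 2 := h3
        _ ≤ 2 / |σ| ^ (m + 1) + (1 + 1 / σ ^ 2) := by
            have : 0 ≤ 2 / |σ| ^ (m + 1) := by positivity
            linarith
    · -- `n < 1`: `t² < 1`, `1/n^{m+1} ≤ 1/|σ|^{m+1}`
      have ht1 : t ^ 2 < 1 := by nlinarith [hnsq, sq_nonneg σ, abs_nonneg t, sq_abs t]
      have h2 : 1 / n ^ (m + 1) ≤ 1 / |σ| ^ (m + 1) :=
        one_div_le_one_div_of_le (by positivity) (pow_le_pow_left₀ hσa.le hnσ _)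
      calc 1 / n ^ (m + 1) * (1 + t ^ 2) ≤ 1 / |σ| ^ (m + 1) * 2 :=
            mul_le_mul h2 (by linarith) h1t.le (by positivity)
        _ = 2 / |σ| ^ (m + 1) := by ring
        _ ≤ 2 / |σ| ^ (m + 1) + (1 + 1 / σ ^ 2) := by
            have : 0 ≤ 1 + 1 / σ ^ 2 := by positivity
            linarith
  calc x ^ σ / n ^ (m + 1) = x ^ σ * (1 / n ^ (m + 1)) := by ring
    _ ≤ x ^ σ * ((2 / |σ| ^ (m + 1) + (1 + 1 / σ ^ 2)) * (1 + t ^ 2)⁻¹) :=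
        mul_le_mul_of_nonneg_left key hxσ
    _ = C * (1 + t ^ 2)⁻¹ := by rw [hCdef]; ring

/-! ### (6.6): the vertical-line integral -/

/-- Horizontal sides of height `|y| = T`:
`‖∫_u^v x^{t+iy} (t+iy)^{−m−1} dt‖ ≤ (M/|y|^{m+1}) |v − u|` if `x^t ≤ M` on the segment.
[folklore] -/
theorem norm_integral_horizontal_le {x : ℝ} (hx : 0 < x) (m : ℕ) {u v y M : ℝ} (hy : y ≠ 0)
    (hM : ∀ t ∈ Ι u v, x ^ t ≤ M) :
    ‖∫ t in u..v, perronPow x m ((t : ℂ) + y * I)‖ ≤ M / |y| ^ (m + 1) * |v - u| := by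
  refine intervalIntegral.norm_integral_le_of_norm_le_const fun t ht => ?_
  refine (norm_perronPow_le_horizontal hx m t hy).trans ?_
  exact div_le_div_of_nonneg_right (hM t ht) (pow_nonneg (abs_nonneg _) _)

/-- Far vertical side: `‖∫_u^v x^{σ+iy} (σ+iy)^{−m−1} dy‖ ≤ (x^σ/|σ|^{m+1}) |v − u|`. [folklore] -/
theorem norm_integral_vertical_le {x : ℝ} (hx : 0 < x) (m : ℕ) {σ : ℝ} (hσ : σ ≠ 0) (u v : ℝ) :
    ‖∫ y in u..v, perronPow x m ((σ : ℂ) + y * I)‖ ≤ x ^ σ / |σ| ^ (m + 1) * |v - u| :=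
  intervalIntegral.norm_integral_le_of_norm_le_const fun y _ => norm_perronPow_le_vertical hx m hσ y

/-- The rate `K₁ (c + T)/T^{m+1} + K₂ T/T^{m+1} → 0` (`m ≥ 1`) of the three vanishing sides.
[folklore] -/
theorem tendsto_error_terms (K₁ K₂ c : ℝ) {m : ℕ} (hm : 1 ≤ m) :
    Tendsto (fun T : ℝ => K₁ * ((c + T) / T ^ (m + 1)) + K₂ * (T / T ^ (m + 1))) atTop (𝓝 0) := by
  have h1 : Tendsto (fun T : ℝ => T⁻¹) atTop (𝓝 0) := tendsto_inv_atTop_zero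
  have h2 : Tendsto (fun T : ℝ => c * (T⁻¹ * T⁻¹) + T⁻¹) atTop (𝓝 (c * (0 * 0) + 0)) :=
    ((h1.mul h1).const_mul c).add h1
  rw [show c * ((0 : ℝ) * 0) + 0 = 0 by ring] at h2
  -- for `T ≥ 1`: `(c+T)/T^{m+1} ≤ |c|/T² + 1/T`; squeeze with the `m + 1 = 2` majorant
  have hmaj : ∀ᶠ T : ℝ in atTop, |K₁ * ((c + T) / T ^ (m + 1)) + K₂ * (T / T ^ (m + 1))| ≤
      |K₁| * (|c| * (T⁻¹ * T⁻¹) + T⁻¹) + |K₂| * T⁻¹ := by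
    filter_upwards [eventually_ge_atTop (1 : ℝ)] with T hT
    have hT0 : 0 < T := by linarith
    have hpow : T ^ 2 ≤ T ^ (m + 1) := pow_le_pow_right₀ hT (by omega)
    have hT2 : 0 < T ^ 2 := by positivity
    have e1 : |(c + T) / T ^ (m + 1)| ≤ |c| * (T⁻¹ * T⁻¹) + T⁻¹ := by
      rw [abs_div, abs_of_pos (pow_pos hT0 _)]
      calc |c + T| / T ^ (m + 1) ≤ (|c| + T) / T ^ (m + 1) :=
            div_le_div_of_nonneg_right ((abs_add_le _ _).trans (by rw [abs_of_pos hT0]))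
              (pow_pos hT0 _).le
        _ ≤ (|c| + T) / T ^ 2 := div_le_div_of_nonneg_left (by positivity) hT2 hpow
        _ = |c| * (T⁻¹ * T⁻¹) + T⁻¹ := by field_simp
    have e2 : |T / T ^ (m + 1)| ≤ T⁻¹ := by
      rw [abs_div, abs_of_pos hT0, abs_of_pos (by positivity)]
      calc T / T ^ (m + 1) ≤ T / T ^ 2 := div_le_div_of_nonneg_left hT0.le hT2 hpow
        _ = T⁻¹ := by field_simp
    calc |K₁ * ((c + T) / T ^ (m + 1)) + K₂ * (T / T ^ (m + 1))|
        ≤ |K₁ * ((c + T) / T ^ (m + 1))| + |K₂ * (T / T ^ (m + 1))| := abs_add_le _ _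
      _ = |K₁| * |(c + T) / T ^ (m + 1)| + |K₂| * |T / T ^ (m + 1)| := by rw [abs_mul, abs_mul]
      _ ≤ |K₁| * (|c| * (T⁻¹ * T⁻¹) + T⁻¹) + |K₂| * T⁻¹ :=
          add_le_add (mul_le_mul_of_nonneg_left e1 (abs_nonneg _))
            (mul_le_mul_of_nonneg_left e2 (abs_nonneg _))
  have hlim : Tendsto (fun T : ℝ => |K₁| * (|c| * (T⁻¹ * T⁻¹) + T⁻¹) + |K₂| * T⁻¹) atTop (𝓝 0) := by
    have h3 : Tendsto (fun T : ℝ => |c| * (T⁻¹ * T⁻¹) + T⁻¹) atTop (𝓝 (|c| * (0 * 0) + 0)) :=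
      ((h1.mul h1).const_mul |c|).add h1
    rw [show |c| * ((0 : ℝ) * 0) + 0 = 0 by ring] at h3
    have := (h3.const_mul |K₁|).add (h1.const_mul |K₂|)
    simpa using this
  exact squeeze_zero_norm' hmaj hlim

/-- **GPY (6.6)** ("We apply the formula `(1/2πi) ∫_(c) x^s s^{−(k+1)} ds = 0` if `0 < x ≤ 1`,
`= (log x)^k/k!` if `x ≥ 1`, for `c > 0`"), in the absolutely convergent cases `k = m ≥ 1` (the
only ones used: `k + ℓ ≥ 1`) and for the parametrised line integral:
`∫_{−∞}^{∞} x^{c+it} (c+it)^{−(m+1)} dt = 2π [x ≥ 1] (log x)^m/m!` (so that `(1/2πi)·(i ∫ … dt)`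
is the printed right-hand side; at `x = 1` both cases give `0`). Proof: the rectangle identity on
`[−T, c] × [−T, T]` (`x ≥ 1`, the left side `≪ T^{−m}`) resp. Cauchy–Goursat on `[c, T] × [−T, T]`
(`x < 1`, the right side `≪ T^{−m}`), horizontal sides `≪ x^c (c+T) T^{−m−1}`, and
`∫_{−T}^{T} → ∫_{−∞}^{∞}` by absolute convergence.
[cite: GoldstonPintzYildirim2009, Section 6 eq. 6.6] -/
theorem integral_perronPow_vertical {x c : ℝ} (hx : 0 < x) (hc : 0 < c) {m : ℕ} (hm : 1 ≤ m) :
    ∫ t : ℝ, perronPow x m ((c : ℂ) + t * I) =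
      if 1 ≤ x then 2 * Real.pi * (((Real.log x : ℝ) : ℂ) ^ m / (m.factorial : ℂ)) else 0 := by
  set R : ℂ := ((Real.log x : ℝ) : ℂ) ^ m / (m.factorial : ℂ) with hRdef
  set VI : ℂ := ∫ t : ℝ, perronPow x m ((c : ℂ) + t * I) with hVIdef
  have hint := integrable_perronPow_vertical hx hm hc.ne'
  -- the truncated integrals converge to `VI`
  have hright :
      Tendsto (fun T : ℝ => ∫ y in (-T)..T, perronPow x m ((c : ℂ) + y * I)) atTop (𝓝 VI) :=
    intervalIntegral_tendsto_integral hint tendsto_neg_atTop_atBot tendsto_id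
  have hIright : Tendsto (fun T : ℝ => I * ∫ y in (-T)..T, perronPow x m ((c : ℂ) + y * I)) atTop
      (𝓝 (I * VI)) := hright.const_mul I
  split_ifs with hx1
  · -- `x ≥ 1`: rectangles `[-T, c] × [-T, T]`
    have hrect : ∀ T : ℝ, 0 < T →
        Literature.Analysis.Complex.rectBoundaryIntegral (perronPow x m) (-T) c (-T) T = 2 * Real.pi * I * R := by
      intro T hT
      exact rectBoundaryIntegral_cpow_div_pow hx m (by linarith) hc (by linarith) hT
    -- `‖I · right(T) − 2πi R‖ ≤ 2 x^c (c+T)/T^{m+1} + 2 T/T^{m+1}`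
    have hbound : ∀ᶠ T : ℝ in atTop,
        ‖I * (∫ y in (-T)..T, perronPow x m ((c : ℂ) + y * I)) - 2 * Real.pi * I * R‖ ≤
          2 * x ^ c * ((c + T) / T ^ (m + 1)) + 2 * (T / T ^ (m + 1)) := by
      filter_upwards [eventually_gt_atTop (0 : ℝ)] with T hT
      have hid := hrect T hT
      rw [Literature.Analysis.Complex.rectBoundaryIntegral_def] at hid
      -- name the four sides
      set bot := ∫ t in (-T)..c, perronPow x m ((t : ℂ) + (-T : ℝ) * I) with hbot
      set top := ∫ t in (-T)..c, perronPow x m ((t : ℂ) + (T : ℝ) * I) with htop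
      set rgt := ∫ y in (-T)..T, perronPow x m ((c : ℂ) + y * I) with hrgt
      set lft := ∫ y in (-T)..T, perronPow x m (((-T : ℝ) : ℂ) + y * I) with hlft
      have hid' : bot - top + I * rgt - I * lft = 2 * Real.pi * I * R := by
        simpa [hbot, htop, hrgt, hlft] using hid
      have heq : I * rgt - 2 * Real.pi * I * R = -bot + top + I * lft := by
        linear_combination hid'
      rw [heq]
      -- bounds on the three small sides
      have hxM : ∀ t ∈ Ι (-T) c, x ^ t ≤ x ^ c := fun t ht => by
        rw [Set.uIoc_of_le (by linarith)] at ht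
        exact Real.rpow_le_rpow_of_exponent_le hx1 ht.2
      have hb1 := norm_integral_horizontal_le hx m (u := -T) (v := c) (y := -T) (by linarith) hxM
      have hb2 := norm_integral_horizontal_le hx m (u := -T) (v := c) (y := T) hT.ne' hxM
      have hb3 := norm_integral_vertical_le hx m (σ := -T) (by linarith) (-T) T
      rw [abs_neg, abs_of_pos hT] at hb1
      rw [abs_of_pos hT] at hb2
      rw [abs_neg, abs_of_pos hT] at hb3
      have hlen : |c - -T| = c + T := by rw [sub_neg_eq_add, abs_of_pos (by linarith)]
      rw [hlen] at hb1 hb2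
      have hlen2 : |T - -T| = 2 * T := by rw [sub_neg_eq_add, abs_of_pos (by linarith)]; ring
      rw [hlen2] at hb3
      have hxT : x ^ (-T) ≤ 1 := Real.rpow_le_one_of_one_le_of_nonpos hx1 (by linarith)
      have hTm : 0 < T ^ (m + 1) := by positivity
      calc ‖-bot + top + I * lft‖ ≤ ‖-bot‖ + ‖top‖ + ‖I * lft‖ := norm_add₃_le
        _ = ‖bot‖ + ‖top‖ + ‖lft‖ := by rw [norm_neg, norm_mul, Complex.norm_I, one_mul]
        _ ≤ x ^ c / T ^ (m + 1) * (c + T) + x ^ c / T ^ (m + 1) * (c + T) +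
              x ^ (-T) / T ^ (m + 1) * (2 * T) := add_le_add (add_le_add hb1 hb2) hb3
        _ ≤ x ^ c / T ^ (m + 1) * (c + T) + x ^ c / T ^ (m + 1) * (c + T) +
              1 / T ^ (m + 1) * (2 * T) := by
            have : x ^ (-T) / T ^ (m + 1) * (2 * T) ≤ 1 / T ^ (m + 1) * (2 * T) :=
              mul_le_mul_of_nonneg_right (div_le_div_of_nonneg_right hxT hTm.le) (by linarith)
            linarith
        _ = 2 * x ^ c * ((c + T) / T ^ (m + 1)) + 2 * (T / T ^ (m + 1)) := by ring
    have hlim : Tendsto (fun T : ℝ => I * ∫ y in (-T)..T, perronPow x m ((c : ℂ) + y * I)) atTop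
        (𝓝 (2 * Real.pi * I * R)) := by
      rw [tendsto_iff_norm_sub_tendsto_zero]
      exact squeeze_zero_norm' (by simpa using hbound) (tendsto_error_terms (2 * x ^ c) 2 c hm)
    have huniq := tendsto_nhds_unique hIright hlim
    -- `I * VI = 2πi R` ⇒ `VI = 2π R`
    have : VI = 2 * Real.pi * R := by
      have h : -I * (I * VI) = -I * (2 * Real.pi * I * R) := congrArg (fun z => -I * z) huniq
      rw [← mul_assoc, show -I * I = 1 by rw [neg_mul, Complex.I_mul_I, neg_neg], one_mul] at h
      rw [h]; ring_nf; rw [Complex.I_sq]; ring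
    exact this
  · -- `x < 1`: rectangles `[c, T] × [-T, T]`, no pole
    push Not at hx1
    have hrect : ∀ T : ℝ, c < T →
        Literature.Analysis.Complex.rectBoundaryIntegral (perronPow x m) c T (-T) T = 0 := by
      intro T hT
      have hT0 : 0 < T := hc.trans hT
      refine Literature.Analysis.Complex.rectBoundaryIntegral_eq_zero_of_differentiableOn hT.le (by linarith) ?_
      intro s hs
      have hsre : c ≤ s.re := hs.1.1
      have hs0 : s ≠ 0 := fun h => by rw [h] at hsre; simp at hsre; linarith
      exact (differentiableAt_perronPow hx m hs0).differentiableWithinAt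
    have hbound : ∀ᶠ T : ℝ in atTop,
        ‖I * (∫ y in (-T)..T, perronPow x m ((c : ℂ) + y * I)) - 0‖ ≤
          2 * x ^ c * ((c + T) / T ^ (m + 1)) + 2 * (T / T ^ (m + 1)) := by
      filter_upwards [eventually_gt_atTop c] with T hTc
      have hT : 0 < T := hc.trans hTc
      have hid := hrect T hTc
      rw [Literature.Analysis.Complex.rectBoundaryIntegral_def] at hid
      set bot := ∫ t in c..T, perronPow x m ((t : ℂ) + (-T : ℝ) * I) with hbot
      set top := ∫ t in c..T, perronPow x m ((t : ℂ) + (T : ℝ) * I) with htop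
      set rgt := ∫ y in (-T)..T, perronPow x m ((T : ℂ) + y * I) with hrgt
      set lft := ∫ y in (-T)..T, perronPow x m ((c : ℂ) + y * I) with hlft
      have hid' : bot - top + I * rgt - I * lft = 0 := by
        simpa [hbot, htop, hrgt, hlft] using hid
      have heq : I * lft - 0 = bot - top + I * rgt := by linear_combination (-1 : ℂ) * hid'
      rw [heq]
      have hxM : ∀ t ∈ Ι c T, x ^ t ≤ x ^ c := fun t ht => by
        rw [Set.uIoc_of_le hTc.le] at ht
        exact Real.rpow_le_rpow_of_exponent_ge hx hx1.le ht.1.le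
      have hb1 := norm_integral_horizontal_le hx m (u := c) (v := T) (y := -T) (by linarith) hxM
      have hb2 := norm_integral_horizontal_le hx m (u := c) (v := T) (y := T) hT.ne' hxM
      have hb3 := norm_integral_vertical_le hx m (σ := T) hT.ne' (-T) T
      rw [abs_neg, abs_of_pos hT] at hb1
      rw [abs_of_pos hT] at hb2 hb3
      have hlen : |T - c| ≤ c + T := by rw [abs_of_pos (by linarith)]; linarith
      have hlen2 : |T - -T| = 2 * T := by rw [sub_neg_eq_add, abs_of_pos (by linarith)]; ring
      rw [hlen2] at hb3
      have hxT : x ^ T ≤ 1 := Real.rpow_le_one hx.le hx1.le hT.le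
      have hTm : 0 < T ^ (m + 1) := by positivity
      have hxc : 0 ≤ x ^ c / T ^ (m + 1) := by positivity
      calc ‖bot - top + I * rgt‖ ≤ ‖bot‖ + ‖top‖ + ‖I * rgt‖ := by
            calc ‖bot - top + I * rgt‖ ≤ ‖bot - top‖ + ‖I * rgt‖ := norm_add_le _ _
              _ ≤ ‖bot‖ + ‖top‖ + ‖I * rgt‖ := by linarith [norm_sub_le bot top]
        _ = ‖bot‖ + ‖top‖ + ‖rgt‖ := by rw [norm_mul, Complex.norm_I, one_mul]
        _ ≤ x ^ c / T ^ (m + 1) * |T - c| + x ^ c / T ^ (m + 1) * |T - c| +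
              x ^ T / T ^ (m + 1) * (2 * T) := add_le_add (add_le_add hb1 hb2) hb3
        _ ≤ x ^ c / T ^ (m + 1) * (c + T) + x ^ c / T ^ (m + 1) * (c + T) +
              1 / T ^ (m + 1) * (2 * T) := by
            have e1 := mul_le_mul_of_nonneg_left hlen hxc
            have e2 : x ^ T / T ^ (m + 1) * (2 * T) ≤ 1 / T ^ (m + 1) * (2 * T) :=
              mul_le_mul_of_nonneg_right (div_le_div_of_nonneg_right hxT hTm.le) (by linarith)
            linarith
        _ = 2 * x ^ c * ((c + T) / T ^ (m + 1)) + 2 * (T / T ^ (m + 1)) := by ring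
    have hlim : Tendsto (fun T : ℝ => I * ∫ y in (-T)..T, perronPow x m ((c : ℂ) + y * I)) atTop
        (𝓝 0) := by
      rw [tendsto_iff_norm_sub_tendsto_zero]
      exact squeeze_zero_norm' (by simpa using hbound) (tendsto_error_terms (2 * x ^ c) 2 c hm)
    have huniq := tendsto_nhds_unique hIright hlim
    have : VI = 0 := by
      have h : -I * (I * VI) = -I * 0 := congrArg (fun z => -I * z) huniq
      rw [mul_zero, ← mul_assoc, show -I * I = 1 by rw [neg_mul, Complex.I_mul_I, neg_neg],
        one_mul] at h
      exact h
    exact this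

end Literature.Analysis.Complex
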